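import Literature.Computability.QuantumComplexity.QueryComplexityProofs
import HarnessLib

/-!
# Discharge of `RazTal2022_thm74` (Raz–Tal, Theorem 7.4: `𝒟` fools bounded-depth circuits)

Topic `Literature/Computability/QuantumComplexity`; proof of the named fact
`Literature.Computability.QuantumComplexity.RazTal2022_thm74` of file `RazTalForrelation`
(R. Raz, A. Tal, *Oracle separation of BQP and PH*, J. ACM 69 (2022), Art. 30, Thm. 7.4;
ECCC TR18-107 has the same numbering): there are a universal `c > 0` and `n₀` such that for
`n ≥ n₀`, `N = 2ⁿ`, `ε = 1/(24 ln N)`, every circuit `A` on `2N` inputs over `acBasis` of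
`acDepth ≤ d` and size `≤ s`, `2 ≤ s`, satisfies
`|𝔼_{z∼𝒟} A(z) − 𝔼_{u∼U} A(u)| ≤ 16 ε (c log s)^{2(d-1)} / √N` (acceptance-indicator form of the
printed `32 ε (c log s)^{2(d-1)} N^{-1/2}` for `{±1}`-valued `A`).

The proof is the composition of two results already in the tree:

* `razTal2022_thm74_of_tal : Tal2017_fourierL1_ac0 → RazTal2022_thm74`
  (file `RazTalBoundedDepth`: §7 as printed — Eq. (2), the `N`-step Gaussian random walk with
  `p = N^{-1/2}`, Claims 5.3, 7.2, 7.3, the exit bound, `n₀ = 20`, `c = max(c_Tal, 2)`);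
* `Tal2017_fourierL1_ac0_holds : Tal2017_fourierL1_ac0` (file `QueryComplexityProofs`: Raz–Tal's
  Lemma 7.1 = Tal, CCC 2017, Cor. 4.8(3), proved from Håstad's multi-switching lemma through
  `SwitchingLemma`, `FourierTails`, `ACFourierTails`).

Nothing new is defined here; the fact stays a `def` and its users `(h : RazTal2022_thm74)`
(`raz_tal_forrelation_of_thm74`, `razTal_claim82`, `exists_oracle_BQPRel_not_subset_PHRel_of_…`)
can now be fed `RazTal2022_thm74_holds`.

## References

* R. Raz, A. Tal, *Oracle separation of BQP and PH*, J. ACM 69 (2022), Art. 30, Thm. 7.4 and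
  Lemma 7.1 [RazTalJACM2022].
* A. Tal, *Tight bounds on the Fourier spectrum of AC⁰*, CCC 2017, Cor. 4.8 [Tal2017].
-/

namespace Literature.Computability.QuantumComplexity

/-- **Raz–Tal, Theorem 7.4, discharged** (`𝒟` fools bounded-depth circuits): the named fact
`RazTal2022_thm74` holds unconditionally — there are a universal constant `c > 0` and `n₀` such
that for `n ≥ n₀`, every `acBasis` circuit on `2N = 2·2ⁿ` inputs of `acDepth ≤ d` and size `≤ s`
(`2 ≤ s`) has `|𝔼_{𝒟} A − 𝔼_U A| ≤ 16 ε (c log s)^{2(d-1)}/√N`, `ε = 1/(24 ln N)`. Obtained from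
Theorem 7.4-from-Lemma 7.1 (`razTal2022_thm74_of_tal`, §7 as printed) and the discharged Lemma 7.1
(`Tal2017_fourierL1_ac0_holds`, Tal 2017, Cor. 4.8(3), via Håstad's multi-switching lemma).
[cite: RazTalJACM2022, Thm. 7.4] -/
theorem RazTal2022_thm74_holds : RazTal2022_thm74 :=
  razTal2022_thm74_of_tal Tal2017_fourierL1_ac0_holds

end Literature.Computability.QuantumComplexity
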